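import Summits.KontsevichZagierPeriods.KontsevichZagierPeriods.Theorems.SymplecticScissorsRealOnePeriodRelationsStubArcSymbolsCov
import Summits.KontsevichZagierPeriods.KontsevichZagierPeriods.Theorems.SymplecticScissorsRealOnePeriodRelationsStubArcSymbolsFlattenPoly
import Mathlib.Analysis.SpecialFunctions.NonIntegrable
import Summits.KontsevichZagierPeriods.KontsevichZagierPeriods.Theorems.SymplecticScissorsRealOnePeriodRelationsStubRealises

/-!
# `RealOnePeriodRelations` (stmt-KontsevichZagierPeriods-10042), line `nash-retraction-thin-strip`:
# stub `stub_arcSymbols`, auxiliary file 6 — Puiseux flattening of a half-cell into a standard piece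

THE FLATTENING STEP of the piece reduction (`flatten`). Data: `h`, a plane curve `P ∈ ℚ̄[x, y]`, a
half-cell `x = p + σ C t`, `t ∈ (0, 1]` (`p` its BAD end, algebraic; `C > 0` algebraic; `σ = ±1`) on
which `h` is analytic and an étale branch of `P = 0` with `h(p + σC) ∈ ℚ̄`, and `r' = [∫_{half-cell} h]`.
Granted the NORMALISED PUISEUX GERM of one-sided semialgebraic germs (hypothesis `hPG` = the registered
statement `CurvePeriodsTransfer.stub_puiseuxGerm` of the sibling crux stmt-11129), the substitution
`x = p + σ C s^q` (rule 2, `ArcSymbols.exists_pullback`) turns `r'` into `[∫_{(0,1)} g]`,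
`g(s) = qC s^{q−1} h(p + σCs^q)`, and `g` is a STANDARD PIECE: absolute integrability forces
`m + q − 1 ≥ 0` (else `|g| ≳ s⁻¹`, `order_nonneg_of_integrable`), so `g = qC s^N φ` extends
analytically to `0` with algebraic Taylor coefficients; `g` is analytic on `[0, 1]`, semialgebraic,
`g(1) ∈ ℚ̄`, and an étale branch on `(0, 1]` of the flattened polynomial of `ArcSymbols.exists_flattenPoly`,
with `G(0, g 0) = 0` by continuity (if the germ vanishes, `h ≡ 0` on the half-cell by the identity
principle and `g = 0`, `G = y`). References: M. Kontsevich, D. Zagier, *Periods* (2001), §1.2 rule (2);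
J. Bochnak, M. Coste, M.-F. Roy, *Real Algebraic Geometry* (1998), §8.1; S. Basu, R. Pollack, M.-F. Roy,
*Algorithms in Real Algebraic Geometry* (2006), Thm. 3.14.
-/

noncomputable section

open scoped BigOperators Topology
open Set MeasureTheory Filter MvPolynomial
open Literature.NumberTheory.Transcendental
open Literature.ModelTheory.ExponentialFields (IsSemialgebraic)

namespace Summit.KontsevichZagierPeriods.SymplecticScissors.RealOnePeriodRelations

namespace ArcSymbols

/-! ## Semialgebraic bookkeeping -/

/-- `{z : ℝ¹ | 0 < z 0 < 1}` is `ℚ`-semialgebraic. [folklore] -/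
theorem isSemialgebraic_unitIoo : IsSemialgebraic ℚ {z : Fin 1 → ℝ | z 0 ∈ Set.Ioo (0 : ℝ) 1} := by
  have h1 := Literature.ModelTheory.ExponentialFields.isSemialgebraic_setOf_eval_pos (k := ℚ)
    (R := ℝ) (MvPolynomial.X (0 : Fin 1) : MvPolynomial (Fin 1) ℚ)
  have h2 := Literature.ModelTheory.ExponentialFields.isSemialgebraic_setOf_eval_pos (k := ℚ)
    (R := ℝ) (1 - MvPolynomial.X (0 : Fin 1) : MvPolynomial (Fin 1) ℚ)
  convert h1.inter h2 using 1
  ext z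
  simp [sub_pos]

/-- A function of one variable which is `ℚ`-semialgebraic on `(0,1)` and takes algebraic values at
`0` and `1` is `ℚ`-semialgebraic on `[0,1]`. [cite: BochnakCosteRoy1998, §2.2] -/
theorem sa_Icc_of_Ioo (g : ℝ → ℝ) (h0 : IsAlgebraic ℚ (g 0)) (h1 : IsAlgebraic ℚ (g 1))
    (hsa : IsSemialgebraicFunOn ℚ {z : Fin 1 → ℝ | z 0 ∈ Set.Ioo (0 : ℝ) 1} (fun z => g (z 0))) :
    IsSemialgebraicFunOn ℚ {z : Fin 1 → ℝ | z 0 ∈ Set.Icc (0 : ℝ) 1} (fun z => g (z 0)) := by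
  have hA : IsSemialgebraicFunOn ℚ {z : Fin 1 → ℝ | z 0 = 0} (fun _ => g 0) :=
    isSemialgebraicFunOn_const_of_isAlgebraic
      (by simpa using isSemialgebraic_setOf_apply_eq_of_isAlgebraic (n := 1) isAlgebraic_zero 0) h0
  have hB : IsSemialgebraicFunOn ℚ {z : Fin 1 → ℝ | z 0 = 1} (fun _ => g 1) :=
    isSemialgebraicFunOn_const_of_isAlgebraic
      (by simpa using isSemialgebraic_setOf_apply_eq_of_isAlgebraic (n := 1) isAlgebraic_one 0) h1
  have hU1 := IsSemialgebraicFunOn.union (F := fun z => g (z 0)) hA hsa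
    (fun z hz => by have hz' : z 0 = 0 := hz; show g (z 0) = g 0; rw [hz'])
    (fun z _ => rfl)
  have hU2 := IsSemialgebraicFunOn.union (F := fun z => g (z 0)) hU1 hB (fun z _ => rfl)
    (fun z hz => by have hz' : z 0 = 1 := hz; show g (z 0) = g 1; rw [hz'])
  convert hU2 using 1
  ext z
  simp only [Set.mem_setOf_eq, Set.mem_union, Set.mem_Icc, Set.mem_Ioo]
  constructor
  · rintro ⟨h1, h2⟩
    rcases h1.eq_or_lt with h | h
    · exact Or.inl (Or.inl h.symm)
    · rcases h2.lt_or_eq with h' | h'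
      · exact Or.inl (Or.inr ⟨h, h'⟩)
      · exact Or.inr h'
  · rintro ((h | ⟨h1, h2⟩) | h)
    exacts [by rw [h]; exact ⟨le_rfl, zero_le_one⟩, ⟨h1.le, h2.le⟩, by rw [h]; exact ⟨zero_le_one, le_rfl⟩]

/-- The flattened integrand `s ↦ h(p + σCs^q) · (qC s^{q−1})` is `ℚ`-semialgebraic on `(0,1)` if
`y ↦ h(p + σCy)` is. [cite: BochnakCosteRoy1998, Prop. 2.2.6] -/
theorem sa_flatIntegrand {h : ℝ → ℝ} {p C σ : ℝ} (q : ℕ) (hCa : IsAlgebraic ℚ C)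
    (hsa : IsSemialgebraicFunOn ℚ {z : Fin 1 → ℝ | z 0 ∈ Set.Ioo (0 : ℝ) 1} (fun z => h (p + σ * C * z 0))) :
    IsSemialgebraicFunOn ℚ {z : Fin 1 → ℝ | z 0 ∈ Set.Ioo (0 : ℝ) 1}
      (fun z => h (p + σ * C * (z 0) ^ q) * (q * C * (z 0) ^ (q - 1))) := by
  have hU := isSemialgebraic_unitIoo
  have hX : IsSemialgebraicFunOn ℚ {z : Fin 1 → ℝ | z 0 ∈ Set.Ioo (0 : ℝ) 1} (fun z => z 0) :=
    (isSemialgebraicFunOn_aeval hU (MvPolynomial.X 0)).congr fun z _ => by simp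
  rcases Nat.eq_zero_or_pos q with hq | hq
  · subst hq
    have hc : IsSemialgebraicFunOn ℚ {z : Fin 1 → ℝ | z 0 ∈ Set.Ioo (0 : ℝ) 1} (fun _ => ((0 : ℕ) : ℝ)) :=
      isSemialgebraicFunOn_natCast hU 0
    exact hc.congr fun z _ => by simp
  · have hmap : IsSemialgebraicMapOn ℚ {z : Fin 1 → ℝ | z 0 ∈ Set.Ioo (0 : ℝ) 1}
        (fun z : Fin 1 → ℝ => fun _ : Fin 1 => (z 0) ^ q) :=
      IsSemialgebraicMapOn.of_forall hU fun _ => hX.fun_pow q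
    have hmaps : MapsTo (fun z : Fin 1 → ℝ => fun _ : Fin 1 => (z 0) ^ q)
        {z : Fin 1 → ℝ | z 0 ∈ Set.Ioo (0 : ℝ) 1} {z : Fin 1 → ℝ | z 0 ∈ Set.Ioo (0 : ℝ) 1} :=
      fun z hz => ⟨pow_pos hz.1 q, pow_lt_one₀ hz.1.le hz.2 (Nat.pos_iff_ne_zero.mp hq)⟩
    have hcomp := IsSemialgebraicFunOn.comp_isSemialgebraicMapOn_holds hsa hmap hmaps
    exact (hcomp.fun_mul (((isSemialgebraicFunOn_natCast hU q).fun_mul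
      (isSemialgebraicFunOn_const_of_isAlgebraic hU hCa)).fun_mul (hX.fun_pow (q - 1)))).congr
      fun z _ => by simp [Function.comp]

/-! ## Integrability forces a non-negative order -/

/-- If `g(s) = K·s^M·φ(s)` on `(0, ε)` with `K ≠ 0`, `φ` continuous at `0` with `φ(0) ≠ 0`, and `g`
is absolutely integrable on `(0,1)`, then `M ≥ 0` (otherwise `|g| ≳ s⁻¹` near `0`). [folklore] -/
theorem order_nonneg_of_integrable {g φ : ℝ → ℝ} {K ε : ℝ} {M : ℤ} (hK : K ≠ 0) (hε : 0 < ε)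
    (hφ : ContinuousAt φ 0) (hφ0 : φ 0 ≠ 0) (hg : ∀ s ∈ Set.Ioo 0 ε, g s = K * s ^ M * φ s)
    (hint : IntegrableOn g (Set.Ioo 0 1)) : 0 ≤ M := by
  by_contra hM
  have hM' : M ≤ -1 := by omega
  -- `|φ| ≥ |φ 0| / 2` near `0`
  have hφpos : 0 < |φ 0| / 2 := by positivity
  obtain ⟨ρ, hρ, hρφ⟩ : ∃ ρ > 0, ∀ s, |s| < ρ → |φ 0| / 2 ≤ |φ s| := by
    have h := Metric.continuousAt_iff.1 hφ (|φ 0| / 2) hφpos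
    obtain ⟨ρ, hρ, hball⟩ := h
    refine ⟨ρ, hρ, fun s hs => ?_⟩
    have h1 : dist (φ s) (φ 0) < |φ 0| / 2 := hball (by simpa [Real.dist_eq] using hs)
    rw [Real.dist_eq] at h1
    linarith [abs_sub_comm (φ 0) (φ s), abs_sub_abs_le_abs_sub (φ 0) (φ s)]
  set δ : ℝ := min (min ε ρ) 1 with hδ
  have hδpos : 0 < δ := by positivity
  have hδε : δ ≤ ε := (min_le_left _ _).trans (min_le_left _ _)
  have hδ1 : δ ≤ 1 := min_le_right _ _
  -- the lower bound `|g s| ≥ (|K| |φ 0| / 2) s⁻¹` on `(0, δ)`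
  have hbound : ∀ s ∈ Set.Ioo 0 δ, |K| * (|φ 0| / 2) * s⁻¹ ≤ |g s| := by
    intro s hs
    have hs1 : s < 1 := hs.2.trans_le hδ1
    rw [hg s ⟨hs.1, hs.2.trans_le hδε⟩, abs_mul, abs_mul]
    have h1 : s⁻¹ ≤ s ^ M := by simpa using zpow_le_zpow_right_of_le_one₀ hs.1 hs1.le hM'
    have h2 : |φ 0| / 2 ≤ |φ s| :=
      hρφ s (by rw [abs_of_pos hs.1]; exact hs.2.trans_le ((min_le_left _ _).trans (min_le_right _ _)))
    have h3 : |s ^ M| = s ^ M := abs_of_pos (zpow_pos hs.1 M)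
    rw [h3]
    have h4 : 0 ≤ |K| * s ^ M := mul_nonneg (abs_nonneg K) (zpow_pos hs.1 M).le
    calc |K| * (|φ 0| / 2) * s⁻¹ ≤ |K| * (|φ 0| / 2) * s ^ M := by gcongr
      _ = |K| * s ^ M * (|φ 0| / 2) := by ring
      _ ≤ |K| * s ^ M * |φ s| := mul_le_mul_of_nonneg_left h2 h4
  -- hence `s⁻¹` would be integrable on `(0, δ)`
  have hKpos : 0 < |K| * (|φ 0| / 2) := mul_pos (abs_pos.mpr hK) hφpos
  have hint' : IntegrableOn (fun s : ℝ => s⁻¹) (Set.Ioo 0 δ) := by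
    have hgδ : IntegrableOn (fun s => (|K| * (|φ 0| / 2))⁻¹ * |g s|) (Set.Ioo 0 δ) :=
      ((hint.mono_set (Set.Ioo_subset_Ioo_right hδ1)).abs).const_mul _
    refine hgδ.mono' ?_ ?_
    · have hc : ContinuousOn (fun s : ℝ => s⁻¹) (Set.Ioo 0 δ) :=
        continuousOn_inv₀.mono fun s hs => (ne_of_gt hs.1 : s ≠ (0 : ℝ))
      exact hc.aestronglyMeasurable measurableSet_Ioo
    · refine (ae_restrict_iff' measurableSet_Ioo).2 (Filter.Eventually.of_forall fun s hs => ?_)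
      rw [Real.norm_eq_abs, abs_of_pos (inv_pos.mpr hs.1), le_inv_mul_iff₀ hKpos]
      exact hbound s hs
  exact not_integrableOn_inv_Ioo hδpos hint'

/-! ## The flattening -/

/-- **PUISEUX FLATTENING OF A HALF-CELL.** See the module docstring: granted the normalised Puiseux
germ `hPG`, the half-cell representation `r' = [∫ h]` over `{p + σCy | y ∈ (0,1)}`, with `h`
analytic and an étale branch of `P = 0` along `(0, 1] ∋ y`, `h(p + σC) ∈ ℚ̄`, pulls back along
`x = p + σCs^q` (rule 2) to `[∫_{(0,1)} g]` with `(g, G)` a standard piece.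
[cite: KontsevichZagier2001, §1.2 rule (2); BochnakCosteRoy1998, §8.1] -/
theorem flatten
    (hPG : ∀ (f : ℝ → ℝ) (a δ : ℝ), IsAlgebraic ℚ a → 0 < δ →
      IsSemialgebraicFunOn ℚ {z : Fin 1 → ℝ | z 0 ∈ Set.Ioo a (a + δ)} (fun z => f (z 0)) →
      ∃ (q : ℕ) (m : ℤ) (h : ℝ → ℝ), 0 < q ∧ AnalyticAt ℝ h 0 ∧ (∀ n, IsAlgebraic ℚ (iteratedDeriv n h 0)) ∧
        (h 0 ≠ 0 ∨ ∀ s, h s = 0) ∧ ∀ᶠ s in 𝓝[>] (0 : ℝ), f (a + s ^ q) = s ^ m * h s)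
    (h : ℝ → ℝ) (P : MvPolynomial (Fin 2) ℝ) (hP : ∀ e, IsAlgebraic ℚ (P.coeff e))
    (p C σ : ℝ) (hp : IsAlgebraic ℚ p) (hC : 0 < C) (hCa : IsAlgebraic ℚ C) (hσ : σ = 1 ∨ σ = -1)
    (han : ∀ x ∈ Set.Ioc (0 : ℝ) 1, AnalyticAt ℝ h (p + σ * C * x))
    (hroot : ∀ x ∈ Set.Ioc (0 : ℝ) 1, MvPolynomial.eval ![p + σ * C * x, h (p + σ * C * x)] P = 0)
    (het : ∀ x ∈ Set.Ioc (0 : ℝ) 1,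
      MvPolynomial.eval ![p + σ * C * x, h (p + σ * C * x)] (MvPolynomial.pderiv 1 P) ≠ 0)
    (halg1 : IsAlgebraic ℚ (h (p + σ * C)))
    (hsa : IsSemialgebraicFunOn ℚ {z : Fin 1 → ℝ | z 0 ∈ Set.Ioo (0 : ℝ) 1} (fun z => h (p + σ * C * z 0)))
    (r' : KZ.IntegralRep 1)
    (hr'dom : r'.domain = {z : Fin 1 → ℝ | z 0 ∈ (fun y => p + σ * C * y) '' Set.Ioo (0 : ℝ) 1})
    (hr'int : ∀ z ∈ r'.domain, r'.integrand z = h (z 0)) :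
    ∃ (g : ℝ → ℝ) (G : MvPolynomial (Fin 2) ℝ) (R : KZ.IntegralRep 1),
      ((∀ e, IsAlgebraic ℚ (G.coeff e)) ∧ (∀ s ∈ Set.Icc (0 : ℝ) 1, AnalyticAt ℝ g s) ∧
        (∀ n, IsAlgebraic ℚ (iteratedDeriv n g 0)) ∧ IsAlgebraic ℚ (g 1) ∧
        IsSemialgebraicFunOn ℚ {z : Fin 1 → ℝ | z 0 ∈ Set.Icc (0 : ℝ) 1} (fun z => g (z 0)) ∧
        (∀ s ∈ Set.Icc (0 : ℝ) 1, MvPolynomial.eval ![s, g s] G = 0) ∧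
        (∀ s ∈ Set.Ioc (0 : ℝ) 1, MvPolynomial.eval ![s, g s] (MvPolynomial.pderiv 1 G) ≠ 0)) ∧
      (R.domain = {z : Fin 1 → ℝ | z 0 ∈ Set.Ioo (0 : ℝ) 1} ∧ ∀ z ∈ R.domain, R.integrand z = g (z 0)) ∧
      KZ.of R - KZ.of r' ∈ KZ.changeOfVariablesRel := by
  /- Step 1: the germ of `y ↦ h(p + σCy)` at `0⁺`. -/
  obtain ⟨q, m, φ, hq, hφan, hφalg, hφ0, hgerm⟩ := hPG (fun y => h (p + σ * C * y)) 0 1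
    isAlgebraic_zero zero_lt_one (by simpa only [zero_add] using hsa)
  simp only [zero_add] at hgerm
  have hq0 : q ≠ 0 := Nat.pos_iff_ne_zero.mp hq
  /- Step 2: the pull-back along `x = p + σ C s^q` (rule 2). -/
  obtain ⟨hφsa, hder, hne, habs, hinj, himage⟩ := powSubst_props p C σ q hq hC hσ hp hCa
  obtain ⟨R, hRdom, hRint, hRcov⟩ := exists_pullback r' (fun s => p + σ * C * s ^ q)
    (fun s => σ * C * (q * s ^ (q - 1))) hφsa (fun s _ => hder s) hinj (by rw [himage, hr'dom])
  -- the new integrand `g₀(s) = h(p + σCs^q) · qCs^{q-1}`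
  set g₀ : ℝ → ℝ := fun s => h (p + σ * C * s ^ q) * (q * C * s ^ (q - 1)) with hg₀
  have hRg₀ : ∀ z ∈ R.domain, R.integrand z = g₀ (z 0) := by
    intro z hz
    rw [hRdom] at hz
    have hmem : (fun _ : Fin 1 => p + σ * C * (z 0) ^ q) ∈ r'.domain := by
      rw [hr'dom]
      exact ⟨(z 0) ^ q, ⟨pow_pos hz.1 q, pow_lt_one₀ hz.1.le hz.2 hq0⟩, rfl⟩
    rw [hRint z, hr'int _ hmem, habs _ hz]
  have hg₀int : IntegrableOn g₀ (Set.Ioo 0 1) := by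
    rw [← integrableOn_comp_apply_iff]
    have h1 : IntegrableOn R.integrand R.domain := R.integrableOn
    rw [hRdom] at h1
    exact h1.congr_fun (fun z hz => hRg₀ z (by rw [hRdom]; exact hz))
      (measurableSet_Ioo.preimage (measurable_pi_apply 0))
  have hpow_mem : ∀ s ∈ Set.Ioc (0 : ℝ) 1, s ^ q ∈ Set.Ioc (0 : ℝ) 1 := fun s hs =>
    ⟨pow_pos hs.1 q, pow_le_one₀ hs.1.le hs.2⟩
  -- analyticity of `g₀` on `(0, 1]`
  have hg₀an : ∀ s ∈ Set.Ioc (0 : ℝ) 1, AnalyticAt ℝ g₀ s := by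
    intro s hs
    have hin : AnalyticAt ℝ (fun s : ℝ => p + σ * C * s ^ q) s :=
      analyticAt_const.add (analyticAt_const.mul (analyticAt_id.pow q))
    have hcomp : AnalyticAt ℝ (fun s : ℝ => h (p + σ * C * s ^ q)) s :=
      (han (s ^ q) (hpow_mem s hs)).comp_of_eq hin rfl
    exact hcomp.mul (analyticAt_const.mul (analyticAt_id.pow (q - 1)))
  have hg₀sa : IsSemialgebraicFunOn ℚ {z : Fin 1 → ℝ | z 0 ∈ Set.Ioo (0 : ℝ) 1} (fun z => g₀ (z 0)) :=
    sa_flatIntegrand q hCa hsa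
  have hg₀1 : IsAlgebraic ℚ (g₀ 1) := by
    simp only [hg₀, one_pow, mul_one]
    exact halg1.mul ((isAlgebraic_nat q).mul hCa)
  /- Step 3: the flattened polynomial. -/
  obtain ⟨G, d, hGalg, hG1, hG2⟩ := exists_flattenPoly P hP p C σ q hp hCa hσ
  have hlam_pos : ∀ s ∈ Set.Ioc (0 : ℝ) 1, 0 < (q : ℝ) * C * s ^ (q - 1) := fun s hs =>
    mul_pos (mul_pos (Nat.cast_pos.mpr hq) hC) (pow_pos hs.1 _)
  -- étaleness of `g₀` w.r.t. `G` on `(0, 1]`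
  have hG₀root : ∀ s ∈ Set.Ioc (0 : ℝ) 1, MvPolynomial.eval ![s, g₀ s] G = 0 := by
    intro s hs
    have h1 := hG1 s (h (p + σ * C * s ^ q))
    rw [hroot (s ^ q) (hpow_mem s hs), mul_zero] at h1
    rw [show g₀ s = q * C * s ^ (q - 1) * h (p + σ * C * s ^ q) by rw [hg₀]; ring]
    exact h1
  have hG₀et : ∀ s ∈ Set.Ioc (0 : ℝ) 1, MvPolynomial.eval ![s, g₀ s] (MvPolynomial.pderiv 1 G) ≠ 0 := by
    intro s hs h0
    have h2 := hG2 s (h (p + σ * C * s ^ q))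
    rw [show g₀ s = q * C * s ^ (q - 1) * h (p + σ * C * s ^ q) by rw [hg₀]; ring] at h0
    rw [h0, mul_zero] at h2
    exact mul_ne_zero (pow_ne_zero _ (hlam_pos s hs).ne') (het (s ^ q) (hpow_mem s hs)) h2.symm
  /- Step 4: the zero germ. -/
  rcases hφ0 with hφ0 | hφ0
  swap
  · -- `φ ≡ 0`: `h ≡ 0` on the half-cell by the identity principle, `g = 0`, `G = y`
    have hzero : ∀ y ∈ Set.Ioc (0 : ℝ) 1, h (p + σ * C * y) = 0 := by
      obtain ⟨ε, hε, hεh⟩ : ∃ ε > 0, ∀ s ∈ Set.Ioo 0 ε, h (p + σ * C * s ^ q) = 0 := by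
        rw [Filter.eventually_iff_exists_mem] at hgerm
        obtain ⟨v, hv, hvh⟩ := hgerm
        obtain ⟨ε, hε, hεv⟩ := mem_nhdsGT_iff_exists_Ioo_subset.1 hv
        exact ⟨ε, hε, fun s hs => by rw [hvh s (hεv hs), hφ0 s, mul_zero]⟩
      set ε' : ℝ := min ε 1 with hε'
      have hε'pos : 0 < ε' := by positivity
      have hF : AnalyticOnNhd ℝ (fun y => h (p + σ * C * y)) (Set.Ioc 0 1) := fun y hy =>
        (han y hy).comp_of_eq (analyticAt_const.add (analyticAt_const.mul analyticAt_id)) rfl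
      set y₀ : ℝ := ε' ^ q / 2 with hy₀
      have hε'q : ε' ^ q ≤ 1 := pow_le_one₀ hε'pos.le (min_le_right _ _)
      have hy₀mem : y₀ ∈ Set.Ioc (0 : ℝ) 1 := ⟨by positivity, by linarith⟩
      have hev : (fun y => h (p + σ * C * y)) =ᶠ[𝓝 y₀] 0 := by
        have hopen : Set.Ioo (0 : ℝ) (ε' ^ q) ∈ 𝓝 y₀ :=
          Ioo_mem_nhds (by positivity) (by rw [hy₀]; linarith [pow_pos hε'pos q])
        filter_upwards [hopen] with y hy
        -- `y = s^q` with `s ∈ (0, ε')`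
        have hcont : ContinuousOn (fun s : ℝ => s ^ q) (Set.Icc 0 ε') := (continuous_pow q).continuousOn
        have hivt := intermediate_value_Ioo hε'pos.le hcont
        simp only [zero_pow hq0] at hivt
        obtain ⟨s, hs, rfl⟩ := hivt hy
        exact hεh s ⟨hs.1, hs.2.trans_le (min_le_left _ _)⟩
      have hEq := hF.eqOn_zero_of_preconnected_of_eventuallyEq_zero isPreconnected_Ioc hy₀mem hev
      exact fun y hy => hEq hy
    have hg₀zero : ∀ s ∈ Set.Ioo (0 : ℝ) 1, g₀ s = 0 := fun s hs => by
      rw [hg₀]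
      show h (p + σ * C * s ^ q) * _ = 0
      rw [hzero (s ^ q) (hpow_mem s ⟨hs.1, hs.2.le⟩), zero_mul]
    refine ⟨fun _ => 0, X 1, R, ⟨fun e => ?_, fun s _ => analyticAt_const, fun n => ?_, isAlgebraic_zero,
      (isSemialgebraicFunOn_natCast Realises.isSemialgebraic_IccDom 0).congr fun z _ => by simp,
      fun s _ => by simp, fun s _ => by simp⟩, ⟨hRdom, fun z hz => ?_⟩, hRcov⟩
    · rw [coeff_X]; split_ifs; exacts [isAlgebraic_one, isAlgebraic_zero]
    · rw [iteratedDeriv_fun_const_zero]; exact isAlgebraic_zero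
    · rw [hRg₀ z hz]; rw [hRdom] at hz; exact hg₀zero _ hz
  /- Step 5: `φ 0 ≠ 0`. Radii: the identity region `ε₀` and the analyticity radius `ρ₁` of `φ`. -/
  obtain ⟨ε₀, hε₀, hid⟩ : ∃ ε₀ > 0, ∀ s ∈ Set.Ioo 0 ε₀, h (p + σ * C * s ^ q) = s ^ m * φ s := by
    rw [Filter.eventually_iff_exists_mem] at hgerm
    obtain ⟨v, hv, hvh⟩ := hgerm
    obtain ⟨ε, hε, hεv⟩ := mem_nhdsGT_iff_exists_Ioo_subset.1 hv
    exact ⟨ε, hε, fun s hs => hvh s (hεv hs)⟩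
  obtain ⟨ρ₁, hρ₁, hρ₁an⟩ : ∃ ρ₁ > 0, ∀ y : ℝ, |y| < ρ₁ → AnalyticAt ℝ φ y := by
    obtain ⟨ρ, hρ, hball⟩ := Metric.eventually_nhds_iff.1 hφan.eventually_analyticAt
    exact ⟨ρ, hρ, fun y hy => hball (by simpa [Real.dist_eq] using hy)⟩
  set δ : ℝ := min (min ε₀ ρ₁) 1 / 2 with hδ
  have hδpos : 0 < δ := by positivity
  have h2δ : 2 * δ = min (min ε₀ ρ₁) 1 := by rw [hδ]; ring
  have hδε₀ : 2 * δ ≤ ε₀ := h2δ ▸ (min_le_left _ _).trans (min_le_left _ _)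
  have hδρ₁ : 2 * δ ≤ ρ₁ := h2δ ▸ (min_le_left _ _).trans (min_le_right _ _)
  /- Step 6: integrability forces `m + q − 1 ≥ 0`; the exponent `N`. -/
  have hKne : (q : ℝ) * C ≠ 0 := mul_ne_zero (Nat.cast_ne_zero.mpr hq0) hC.ne'
  have hzpow : ∀ s : ℝ, 0 < s → s ^ m * s ^ (q - 1) = s ^ (m + ((q - 1 : ℕ) : ℤ)) := fun s hs => by
    rw [zpow_add₀ hs.ne', zpow_natCast]
  have hM : 0 ≤ m + ((q - 1 : ℕ) : ℤ) := by
    refine order_nonneg_of_integrable (g := g₀) (φ := φ) hKne hε₀ hφan.continuousAt hφ0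
      (fun s hs => ?_) hg₀int
    show h (p + σ * C * s ^ q) * (q * C * s ^ (q - 1)) = q * C * s ^ (m + ((q - 1 : ℕ) : ℤ)) * φ s
    rw [hid s hs, ← hzpow s hs.1]; ring
  set N : ℕ := (m + ((q - 1 : ℕ) : ℤ)).toNat with hN
  have hNz : (N : ℤ) = m + ((q - 1 : ℕ) : ℤ) := Int.toNat_of_nonneg hM
  have hpowN : ∀ s : ℝ, 0 < s → s ^ m * s ^ (q - 1) = s ^ N := fun s hs => by
    rw [hzpow s hs, ← hNz, zpow_natCast]
  have hg₀id : ∀ s ∈ Set.Ioo 0 ε₀, g₀ s = q * C * s ^ N * φ s := by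
    intro s hs
    show h (p + σ * C * s ^ q) * (q * C * s ^ (q - 1)) = q * C * s ^ N * φ s
    rw [hid s hs, ← hpowN s hs.1]; ring
  /- Step 7: the global standard piece `g`. -/
  set g : ℝ → ℝ := fun s => if s < δ then q * C * s ^ N * φ s else g₀ s with hg
  have hg_lt : ∀ s, s < δ → g s = q * C * s ^ N * φ s := fun s hs => by simp [hg, hs]
  have hg_pos : ∀ s, 0 < s → g s = g₀ s := by
    intro s hs
    by_cases h' : s < δ
    · rw [hg_lt s h', hg₀id s ⟨hs, by linarith⟩]
    · simp [hg, h']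
  have hg_ev0 : g =ᶠ[𝓝 0] fun s => q * C * s ^ N * φ s := by
    filter_upwards [Iio_mem_nhds hδpos] with s hs
    exact hg_lt s hs
  -- analyticity on `[0, 1]`
  have hg_an : ∀ s ∈ Set.Icc (0 : ℝ) 1, AnalyticAt ℝ g s := by
    intro s hs
    by_cases h' : s < δ
    · have hsρ : |s| < ρ₁ := by rw [abs_of_nonneg hs.1]; linarith
      have hmodel : AnalyticAt ℝ (fun s => q * C * s ^ N * φ s) s :=
        (analyticAt_const.mul (analyticAt_id.pow N)).mul (hρ₁an s hsρ)
      refine hmodel.congr ?_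
      filter_upwards [Iio_mem_nhds h'] with x hx
      exact (hg_lt x hx).symm
    · have hspos : 0 < s := hδpos.trans_le (not_lt.mp h')
      refine (hg₀an s ⟨hspos, hs.2⟩).congr ?_
      filter_upwards [Ioi_mem_nhds hspos] with x hx
      exact (hg_pos x hx).symm
  -- Taylor coefficients at `0`
  have hg_tay : ∀ n, IsAlgebraic ℚ (iteratedDeriv n g 0) := by
    intro n
    rw [hg_ev0.iteratedDeriv_eq n]
    have h1 : (fun s : ℝ => q * C * s ^ N * φ s) = fun s => ((q : ℝ) * C) * (s ^ N * φ s) := by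
      funext s; ring
    have hcd : ContDiffAt ℝ n (fun s : ℝ => s ^ N * φ s) 0 :=
      (contDiff_id.pow N).contDiffAt.mul (hφan.contDiffAt.of_le le_top)
    rw [h1, iteratedDeriv_const_mul ((q : ℝ) * C) hcd]
    exact ((isAlgebraic_nat q).mul hCa).mul (isAlgebraic_iteratedDeriv_pow_mul hφan hφalg N n)
  -- end values and semialgebraicity
  have hg1 : g 1 = g₀ 1 := hg_pos 1 one_pos
  have hg1alg : IsAlgebraic ℚ (g 1) := by rw [hg1]; exact hg₀1
  have hg0alg : IsAlgebraic ℚ (g 0) := by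
    rw [hg_lt 0 hδpos]
    have hφ0alg : IsAlgebraic ℚ (φ 0) := by simpa using hφalg 0
    exact (((isAlgebraic_nat q).mul hCa).mul (isAlgebraic_zero.pow N)).mul hφ0alg
  have hg_sa : IsSemialgebraicFunOn ℚ {z : Fin 1 → ℝ | z 0 ∈ Set.Icc (0 : ℝ) 1} (fun z => g (z 0)) :=
    sa_Icc_of_Ioo g hg0alg hg1alg (hg₀sa.congr fun z hz => (hg_pos (z 0) hz.1).symm)
  -- the étale branch of `G` on `(0, 1]`, the root at `s = 0` by continuity
  have hIoc : ∀ s ∈ Set.Ioc (0 : ℝ) 1, MvPolynomial.eval ![s, g s] G = 0 := fun s hs => by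
    rw [hg_pos s hs.1]; exact hG₀root s hs
  have hGroot : ∀ s ∈ Set.Icc (0 : ℝ) 1, MvPolynomial.eval ![s, g s] G = 0 := by
    intro s hs
    rcases hs.1.eq_or_lt with h0 | h0
    · rw [← h0]
      have hcont : ContinuousAt (fun s => MvPolynomial.eval ![s, g s] G) 0 := by
        have hc : Continuous fun v : Fin 2 → ℝ => MvPolynomial.eval v G := MvPolynomial.continuous_eval G
        have hv : ContinuousAt (fun s : ℝ => (![s, g s] : Fin 2 → ℝ)) 0 := by
          refine continuousAt_pi.2 fun i => ?_
          fin_cases i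
          · exact continuousAt_id
          · exact (hg_an 0 ⟨le_rfl, zero_le_one⟩).continuousAt
        exact hc.continuousAt.comp hv
      exact eq_zero_of_forall_Ioc hcont hIoc
    · exact hIoc s ⟨h0, hs.2⟩
  have hGet : ∀ s ∈ Set.Ioc (0 : ℝ) 1, MvPolynomial.eval ![s, g s] (MvPolynomial.pderiv 1 G) ≠ 0 :=
    fun s hs => by rw [hg_pos s hs.1]; exact hG₀et s hs
  refine ⟨g, G, R, ⟨hGalg, hg_an, hg_tay, hg1alg, hg_sa, hGroot, hGet⟩, ⟨hRdom, fun z hz => ?_⟩, hRcov⟩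
  rw [hRg₀ z hz]; rw [hRdom] at hz; exact (hg_pos _ hz.1).symm

end ArcSymbols

/-- **Registered anchor `helper_arcSymbols_6`** (semialgebraic on `(0,1)` with algebraic end values
implies semialgebraic on `[0,1]`). [cite: BochnakCosteRoy1998, §2.2] -/
theorem helper_arcSymbols_6 : ∀ (g : ℝ → ℝ), IsAlgebraic ℚ (g 0) → IsAlgebraic ℚ (g 1) → IsSemialgebraicFunOn ℚ {z : Fin 1 → ℝ | z 0 ∈ Set.Ioo (0 : ℝ) 1} (fun z => g (z 0)) → IsSemialgebraicFunOn ℚ {z : Fin 1 → ℝ | z 0 ∈ Set.Icc (0 : ℝ) 1} (fun z => g (z 0)) :=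
  ArcSymbols.sa_Icc_of_Ioo

end Summit.KontsevichZagierPeriods.SymplecticScissors.RealOnePeriodRelations

end
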